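import Summits.ABC.IUTFork.Joshi.AdelicAnsatzDerived
import Summits.ABC.IUTFork.Joshi.PrimitiveAnsatz
import HarnessLib

/-!
# [J-III] Thm. 4.2.2.1 (1), (2), (4) SUPPLIED: the three [J-IIp] inputs of `Joshi/AdelicAnsatz.lean`
# (`PrimAnsatzGaloisStable`, `PrimAnsatzFrobeniusInvariant`, `PrimAnsatzScaling`) DERIVED from E-t3's typed
# prototype datum `PrototypeDatum` ([J-IIp] Def. 6.2.3, Prop. 6.6.1 / 6.7.1, Thm. 6.9.1 — kernel theorems
# `primitiveAnsatz_frob`, `primitiveAnsatz_gal`, `scale_ansatzPt`) along a typed gluing certificate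

Proof-only companion (abc-iut cell, block E «type Joshi's construction, test vs S», rung LADDER-ABC:A2.E; seat
abc-iut-E-t57, batch-3 slot «[J-IIp] DERIVABLE/SUPPLIER seat», abc-iut-E-plan-2 2026-08-26T07:46:39Z) of
`Joshi/AdelicAnsatz.lean` (abc-iut-E-t7, p428940; its module docstring records the MERGE-DEBT discharged here: «the field
`primAnsatz` below is that set [E-t3's `primitiveAnsatz`] and the three INPUT `Prop`s of §3 are E-t3's Prop. 6.6.1 / 6.7.1 /
Thm. 6.9.1 rows») and `Joshi/AdelicAnsatzDerived.lean` (p429123), over E-t3's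
`Joshi/PrimitiveAnsatz.lean` (p428639). SOURCES: K. Joshi, arXiv:2401.13508v4 = [J-III] (unrefereed preprint
«Preliminary version for comments»; bib `Joshi2024ATS3`; render `HOME/lit/renders/Joshi-arxiv-2401.13508/pNNNN.txt`,
«p.N l.M» = line M of PDF page N), §4.2.1–§4.2.2 pp.32–33; arXiv:2303.01662v3 = [J-IIp] (bib `Joshi2023ATS2Local`; render
`HOME/lit/renders/Joshi-arxiv-2303.01662/`), §6.2–§6.9 pp.15–18. TAKES NO SIDE on [IUTchIII] Cor. 3.12, on Joshi's claims or
on Mochizuki's report on them; typed ≠ proved ≠ endorsed. Object-side file (E-PLAN R14: imports Joshi object files only; no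
`Cor312*` / `Thm311*` import). No FACT-LIST row is consumed; no new `Prop` is introduced; nothing is asserted.

WHAT IS TYPED AND PROVED.

* §1 `AdelicCurveDatum.PrototypeSupply D` — a CERTIFICATE (data + equations, no asserted property) that the `ℚ_p`-level of an
  adelic curve datum `D` ([J-III] §4.2.1, the target `|Y_{C_p^♭,ℚ_p}|` of the forgetful map (4.2.1.2), its Galois action and
  Frobenius, its residue valuations, and the INPUT field `primAnsatz` = Mochizuki's primitive Ansatz (4.2.1.5)) IS, prime by
  prime, E-t3's typed [J-IIp] prototype: for every residue characteristic `p : D.P` a `PrototypeDatum` `Π_p` ON THE SAME point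
  type `D.Y0 p` and Galois index type `D.G0 p`, with `g0act = galY` (§6.7), `⇑frob0 = frobY` (§6.6), the residue valuation of
  `D` read through the isometric embedding `ι_y : Ē ↪ K_y` of Thm. 6.9.1 (3) — `absK0 p y s = |ι_y(e_p s)|_{K_y}` for a map
  `e_p : D.T p → Ē` of the common evaluation domain (E-t7's modelling choice (d)) —, `primAnsatz p =` E-t3's `primitiveAnsatz`
  (Def. 6.2.3; the two `ℓ⋆`'s identified, `lstar_eq`), and ONE printed input as an explicit binder: «`F = C_p^♭` is a perfect
  field» in the form every `b ∈ F` has a `p`-th root ([J-IIp] §2.1 p.7 l.10–14 «`F` … an algebraically closed perfectoid field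
  of characteristic `p > 0`»; [J-III] p.33 l.46–47 uses `ϕ`-INVARIANCE, i.e. `ϕ^{−1}` as well — E-t7's `↔` form of
  `PrimAnsatzFrobeniusInvariant`).
* §2 THE THREE INPUTS DERIVED along a certificate `σ` (FQ-typed): `σ.primAnsatzGaloisStable : D.PrimAnsatzGaloisStable`
  (← `PrototypeDatum.primitiveAnsatz_gal`, [J-IIp] Prop. 6.7.1), `σ.primAnsatzFrobeniusInvariant : D.PrimAnsatzFrobeniusInvariant`
  (→ `primitiveAnsatz_frob`, Prop. 6.6.1; ← perfectness + injectivity of the bijection `frob0`), `σ.primAnsatzScaling :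
  D.PrimAnsatzScaling` (← `scale_ansatzPt` / `absK_emb`, Thm. 6.9.1 (1)(3)).
* §3 CONSEQUENCES, now unconditional over any supplied `D`: E-t7's [J-III] Thm. 4.2.2.1 (1) `ansatzGaloisStable_of`, (2)
  `ansatzFrobeniusStable_of` and its `ϕ^ℤ`-form, (3) in the diagonal reading MODULO the [J-2½] input `LStarThroughFrobenius`
  only, (4) `valuationScaling_of`; and `absK_eq_rpow` (every residue valuation of `D` is `|e(t)|_0 ^ scale`), `absK_pos`,
  `absK_ne_one` — the positivity / non-triviality binders of E-t7's `Joshi/AdelicAnsatzScaling.lean` chain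
  (`absK_eq_rpow_scalingExponent` = the step «(9.9.3) ⟹ (9.9.4)», `not_valuationDiagonal_of_valuationScaling`) REDUCED to
  `e(t) ≠ 0` and `|e(t)|_0 ≠ 1` in `Ē`; their supplied one-line forms are a follow-up APPEND (that module is being rebuilt
  behind E-t7's 07:41Z append at the time of filing, so it is not imported here).
* §4 SATISFIABILITY of the certificate RELATIVE TO E-t3's carrier (`PrototypeFamily.toAdelicCurveDatum` / `.supply`): every
  family of prototype data whose
  point-Frobenius is a bijection and whose tilts are perfect is the `ℚ_p`-level of an adelic curve datum carrying a
  certificate (the «local = global» datum: one place per prime, forgetful map the identity, `L′*` acting trivially — NO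
  arithmetic content, it only shows that §1 asks nothing beyond E-t3's signature + the two binders). An HONEST instance waits
  on E-t3's O1 model of `PrototypeDatum` (`Joshi/TestThetaValuesLocusModel.lean`, building 2026-08-26T07:32Z).

REGISTRY GRAMMAR (abc-iut-E-dag): «E SUPPLY J3:Thm4.2.2.1(1)(2)(4) / PrimAnsatz{GaloisStable,FrobeniusInvariant,Scaling}:
DERIVED from J2p:Prop6.7.1 + J2p:Prop6.6.1 + J2p:Thm6.9.1 (E-t3 p428639) MODULO the gluing certificate `PrototypeSupply` +
«F perfect»; no located residual». Deliberately NOT here: the `w`-level of `D` (the curves `Y_{C_p^♭,L′_w}`, [J-2½] Thm. 4.2.3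
— no block-E carrier constructs them), `LStarThroughFrobenius` ([J-2½] Thm. 4.2.3 (4), stays a binder), any judgement.
-/

noncomputable section

namespace Summit.ABC.IUTFork.Joshi

namespace AdelicCurveDatum

variable (D : AdelicCurveDatum)

/-! ## 1. The gluing certificate: `D`'s `ℚ_p`-level is a family of E-t3 prototype data -/

/-- **`PrototypeSupply D`** — a gluing CERTIFICATE (data and equations; NO property of [J-III] is asserted): for every residue
characteristic `p : D.P` the `ℚ_p`-level of `D` ([J-III] §4.2.1 p.32 l.19–59: `|Y_{C_p^♭,ℚ_p}|` with its `G_{ℚ_p}`-action,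
Frobenius, residue valuations, and the INPUT (4.2.1.5) «Mochizuki's primitive ansatz `Σ̃_{C_p^♭} ⊂ Y^{ℓ*}_{C_p^♭,ℚ_p}` of
[Joshi, 2023b, §6]») is READ THROUGH a prototype datum `proto p` of E-t3 (`Joshi/PrimitiveAnsatz.lean`: [J-IIp] §§2–7 over
the carriers `F` = the tilt, `B` = the Fargues–Fontaine ring, `E0` = `Ē`, the points `D.Y0 p`, residue fields `K p y`, Galois
index `D.G0 p`): `gal_eq` (§6.7 p.17 l.1–6: the Galois action on points), `frob_eq` (§6.6 p.16 l.43–47: the Frobenius on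
points), `absK0_eq` (Thm. 6.9.1 (3) p.17 l.55 – p.18 l.1: «for `z ∈ Ē ⊂ K_j` … `|z|_{K_j}`» — `D`'s common evaluation
domain `T p` is sent into `Ē` by `toE0 p`, and `|−|_{K_y}` is E-t3's `absK y ∘ ι_y`), `primAnsatz_eq` (Def. 6.2.3 p.15
l.28–33, with `lstar_eq` identifying the two `ℓ⋆`), and the binder `perfect` («`F` … perfectoid field of characteristic
`p > 0`», [J-IIp] §2.1 p.7 l.10–14: every element has a `p`-th root — used only for the `ϕ^{−1}`-half of E-t7's
`PrimAnsatzFrobeniusInvariant`). The carriers are PARAMETERS (no instance is declared).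
[claim: Joshi2024ATS3, status: disputed] -/
structure PrototypeSupply (F B E0 : D.P → Type) [∀ p, Field (F p)] [∀ p, CommRing (B p)] [∀ p, Field (E0 p)]
    (K : (p : D.P) → D.Y0 p → Type) [∀ p (y : D.Y0 p), Field (K p y)] : Type 1 where
  /-- the prototype datum of E-t3 at the residue characteristic `p` ([J-IIp] §§2–7), on `D`'s own points `D.Y0 p` -/
  proto : (p : D.P) → PrototypeDatum (F p) (B p) (E0 p) (D.Y0 p) (K p) (D.G0 p)
  /-- the two `ℓ⋆ = (ℓ − 1)/2` agree ([J-III] §3.3 (11); [J-IIp] §5.1) -/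
  lstar_eq : ∀ p, (proto p).lstar = D.lstar
  /-- `D`'s `G_{ℚ_p}`-type action on `|Y_{C_p^♭,ℚ_p}|` IS the Galois action on points of [J-IIp] §6.7 -/
  gal_eq : ∀ (p : D.P) (g : D.G0 p) (y : D.Y0 p), D.g0act p g y = (proto p).galY g y
  /-- `D`'s Frobenius of `|Y_{C_p^♭,ℚ_p}|` IS the point-Frobenius of [J-IIp] §6.6 -/
  frob_eq : ∀ (p : D.P) (y : D.Y0 p), D.frob0 p y = (proto p).frobY y
  /-- the common evaluation domain `T p` of `D`'s residue valuations is read inside `Ē` -/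
  toE0 : (p : D.P) → D.T p → E0 p
  /-- `|s|_{K_y} = |ι_y(e_p s)|_{K_y}` ([J-IIp] Thm. 6.9.1 (3): valuations are compared on `Ē ⊂ K_y`) -/
  absK0_eq : ∀ (p : D.P) (y : D.Y0 p) (s : D.T p),
    D.absK0 p y s = (proto p).absK y ((proto p).emb y (toE0 p s))
  /-- (4.2.1.5): `D`'s primitive ansatz IS E-t3's `primitiveAnsatz` (Def. 6.2.3), indices matched along `lstar_eq` -/
  primAnsatz_eq : ∀ (p : D.P) (t : Fin D.lstar → D.Y0 p),
    t ∈ D.primAnsatz p ↔ (fun i : Fin (proto p).lstar => t (Fin.cast (lstar_eq p) i)) ∈ (proto p).primitiveAnsatz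
  /-- «`F` is a perfect(oid) field of characteristic `p`»: `p`-th roots exist ([J-IIp] §2.1 p.7 l.10–14) -/
  perfect : ∀ (p : D.P) (b : F p), ∃ a : F p, a ^ (proto p).p = b

namespace PrototypeSupply

variable {D}
variable {F B E0 : D.P → Type} [∀ p, Field (F p)] [∀ p, CommRing (B p)] [∀ p, Field (E0 p)]
  {K : (p : D.P) → D.Y0 p → Type} [∀ p (y : D.Y0 p), Field (K p y)] (σ : D.PrototypeSupply F B E0 K)

include σ

/-- Index bookkeeping: casting a label of `D` to a label of `proto p` and back is the identity. [folklore] -/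
theorem cast_cast_symm (p : D.P) (j : Fin D.lstar) :
    Fin.cast (σ.lstar_eq p) (Fin.cast (σ.lstar_eq p).symm j) = j :=
  Fin.ext rfl

/-- Index bookkeeping: the printed index `j = i + 1` is unchanged by the cast. [folklore] -/
theorem printedIndex_eq_cast (p : D.P) (j : Fin D.lstar) :
    D.printedIndex j = ((Fin.cast (σ.lstar_eq p).symm j : Fin (σ.proto p).lstar) : ℕ) + 1 :=
  rfl

/-- **(4.2.1.5) = Def. 6.2.3, cast-free form**: a tuple of `D.Y0 p` lies in `D`'s primitive ansatz iff it is
`(y_1(a), …, y_{ℓ⋆}(a))`, `y_j(a) =` the point of `[a^{j²}] − p`, for some `a ∈ 𝔪_F ∖ 0` ([J-IIp] Def. 6.2.3 p.15 l.28–33).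
DERIVED from `primAnsatz_eq`. [claim: Joshi2023ATS2Local, status: disputed] -/
theorem mem_primAnsatz_iff (p : D.P) (t : Fin D.lstar → D.Y0 p) :
    t ∈ D.primAnsatz p ↔
      ∃ a ∈ (σ.proto p).AnsatzParam, ∀ j : Fin D.lstar, t j = (σ.proto p).pt (a ^ D.printedIndex j ^ 2) := by
  rw [σ.primAnsatz_eq]
  constructor
  · rintro ⟨a, ha, hat⟩
    refine ⟨a, ha, fun j => ?_⟩
    have h := congrFun hat (Fin.cast (σ.lstar_eq p).symm j)
    rw [σ.cast_cast_symm] at h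
    rw [h, σ.printedIndex_eq_cast p j]
    rfl
  · rintro ⟨a, ha, hat⟩
    refine ⟨a, ha, funext fun i => ?_⟩
    rw [hat]
    rfl

/-! ## 2. The three INPUT `Prop`s of `Joshi/AdelicAnsatz.lean` §3, DERIVED from E-t3's kernel theorems -/

/-- **INPUT [J-IIp] Prop. 6.7.1 SUPPLIED**: along a certificate, `D.PrimAnsatzGaloisStable` ([J-III] p.33 l.45 «`Σ̃_{C_p^♭}` is
Galois stable») IS E-t3's kernel theorem `PrototypeDatum.primitiveAnsatz_gal` («`σ([a^{j²}] − p) = [σ(a)^{j²}] − p`», [J-IIp]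
p.17 l.1–23). [claim: Joshi2023ATS2Local, status: disputed] -/
theorem primAnsatzGaloisStable : D.PrimAnsatzGaloisStable := by
  intro p g t ht
  rw [σ.primAnsatz_eq] at ht ⊢
  have h := (σ.proto p).primitiveAnsatz_gal g ht
  simp only [σ.gal_eq]
  exact h

/-- The point-Frobenius of the prototype carries the ansatz tuple of `a` to the ansatz tuple of `a^p`
(«`[φ(a^{j²})] − p = [b^{j²}] − p`, `b = a^p`», [J-IIp] p.16 l.43–64) — the computation inside E-t3's `primitiveAnsatz_frob`,
needed pointwise for the `ϕ^{−1}`-half below. [claim: Joshi2023ATS2Local, status: disputed] -/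
theorem frobY_ansatzPt (p : D.P) (a : F p) (i : Fin (σ.proto p).lstar) :
    (σ.proto p).frobY ((σ.proto p).ansatzPt a i) = (σ.proto p).ansatzPt (a ^ (σ.proto p).p) i := by
  unfold PrototypeDatum.ansatzPt
  rw [← (σ.proto p).pt_frob, pow_right_comm]

/-- A `p`-th root of an ansatz parameter is an ansatz parameter (`a^p ≠ 0 ⟹ a ≠ 0`; `|a|^p < 1 ⟹ |a| < 1`). [folklore] -/
theorem mem_ansatzParam_of_pow (p : D.P) {a : F p} (h : a ^ (σ.proto p).p ∈ (σ.proto p).AnsatzParam) :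
    a ∈ (σ.proto p).AnsatzParam := by
  refine ⟨fun ha => h.1 (by rw [ha, zero_pow (σ.proto p).p_prime.ne_zero]), ?_⟩
  have h2 := h.2
  rw [map_pow] at h2
  exact (pow_lt_one_iff_of_nonneg ((σ.proto p).absF.nonneg a) (σ.proto p).p_prime.ne_zero).1 h2

/-- **INPUT [J-IIp] Prop. 6.6.1 SUPPLIED, in E-t7's `↔` form**: along a certificate, `D.PrimAnsatzFrobeniusInvariant` ([J-III]
p.33 l.46–47 «`Σ̃_{C_p^♭}` is `ϕ`-invariant») holds — the `ϕ`-half IS E-t3's `PrototypeDatum.primitiveAnsatz_frob`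
([J-IIp] Prop. 6.6.1 p.16 l.43–64), the `ϕ^{−1}`-half uses the binder `perfect` («`C_p^♭` is perfect») and the injectivity of
the bijection `D.frob0 p`: if `(ϕ(y_j))_j` is the tuple of `b = a^p` then `(y_j)_j` is the tuple of `a`.
[claim: Joshi2023ATS2Local, status: disputed] -/
theorem primAnsatzFrobeniusInvariant : D.PrimAnsatzFrobeniusInvariant := by
  intro p t
  rw [σ.primAnsatz_eq, σ.primAnsatz_eq]
  constructor
  · intro ht
    have h := (σ.proto p).primitiveAnsatz_frob ht
    simp only [σ.frob_eq]
    exact h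
  · rintro ⟨b, hb, hbt⟩
    obtain ⟨a, rfl⟩ := σ.perfect p b
    refine ⟨a, σ.mem_ansatzParam_of_pow p hb, funext fun i => ?_⟩
    have h := congrFun hbt i
    simp only [σ.frob_eq] at h
    rw [← σ.frobY_ansatzPt, ← σ.frob_eq, ← σ.frob_eq] at h
    exact (D.frob0 p).injective h

/-- Along a certificate every residue valuation at the `ℚ_p`-level is E-t3's scaling law `|ι_y(z)|_{K_y} = |z|_0^{scale y}`
([FF18, Prop. 2.2.17] as used [J-IIp] p.18 l.7–9). [claim: Joshi2023ATS2Local, status: disputed] -/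
theorem absK0_eq_rpow (p : D.P) (y : D.Y0 p) (s : D.T p) :
    D.absK0 p y s = (σ.proto p).abs0 (σ.toE0 p s) ^ (σ.proto p).scale y := by
  rw [σ.absK0_eq, (σ.proto p).absK_emb]

/-- The scaling exponent of the `j`-th point of a primitive-ansatz tuple is `j²` times that of the first ([J-IIp] Thm. 6.9.1
(1), E-t3's `scale_ansatzPt`, transported along `primAnsatz_eq`). [claim: Joshi2023ATS2Local, status: disputed] -/
theorem scale_eq_of_mem_primAnsatz (p : D.P) {t : Fin D.lstar → D.Y0 p} (ht : t ∈ D.primAnsatz p) (j : Fin D.lstar) :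
    (σ.proto p).scale (t j) = (D.printedIndex j ^ 2 : ℕ) * (σ.proto p).scale (t D.jOne) := by
  obtain ⟨a, ha, hat⟩ := (σ.primAnsatz_eq p t).1 ht
  have htj : ∀ j : Fin D.lstar, t j = (σ.proto p).ansatzPt a (Fin.cast (σ.lstar_eq p).symm j) := fun j => by
    have h := congrFun hat (Fin.cast (σ.lstar_eq p).symm j)
    rwa [σ.cast_cast_symm] at h
  rw [htj j, htj D.jOne, (σ.proto p).scale_ansatzPt ha, (σ.proto p).scale_ansatzPt ha, σ.printedIndex_eq_cast p j]
  have h0 : (((Fin.cast (σ.lstar_eq p).symm D.jOne : Fin (σ.proto p).lstar) : ℕ) + 1) ^ 2 = 1 := by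
    simp [AdelicCurveDatum.jOne]
  rw [h0]
  push_cast
  ring

/-- **INPUT [J-IIp] Thm. 6.9.1 SUPPLIED**: along a certificate, `D.PrimAnsatzScaling` ([J-III] p.33 l.65–67 «by [Joshi, 2023b,
Thm. 6.9.1] one has `|−|_{K_{y_{p,j}}} = |−|^{j²}_{K_{y_{p,1}}}`») holds — the exponent law of E-t3's `PrototypeDatum.scale_ansatzPt`
(`v_{K_j}(p) = j²·v_{K_1}(p)`, [J-IIp] p.18 l.4–6) read on `Ē` through `absK_emb` (Thm. 6.9.1 (3)); real arithmetic
`x^{j²·c} = (x^c)^{j²}`. [claim: Joshi2023ATS2Local, status: disputed] -/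
theorem primAnsatzScaling : D.PrimAnsatzScaling := by
  intro p t ht j s
  rw [σ.absK0_eq_rpow, σ.absK0_eq_rpow, σ.scale_eq_of_mem_primAnsatz p ht j, mul_comm,
    Real.rpow_mul ((σ.proto p).abs0.nonneg _), Real.rpow_natCast]

/-! ## 3. Consequences: E-t7's Thm. 4.2.2.1 (1), (2), (4) unconditional along a certificate; the binders of the scaling chain -/

/-- **[J-III] Thm. 4.2.2.1 (1) along a certificate** (p.32 l.76–80: «`Σ̃_{L′}` is stable under the natural action of
`G_{L′}`»): E-t7's `ansatzGaloisStable_of` with its input supplied. [claim: Joshi2024ATS3, status: disputed] -/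
theorem ansatzGaloisStable : D.AnsatzGaloisStable :=
  D.ansatzGaloisStable_of σ.primAnsatzGaloisStable

/-- **[J-III] Thm. 4.2.2.1 (2) along a certificate** (p.32 l.81–84: «`Σ̃_{L′}` is stable under … the (global) Frobenius
`ϕ`»): E-t7's `ansatzFrobeniusStable_of` with its input supplied. [claim: Joshi2024ATS3, status: disputed] -/
theorem ansatzFrobeniusStable : D.AnsatzFrobeniusStable :=
  D.ansatzFrobeniusStable_of σ.primAnsatzFrobeniusInvariant

/-- **Def. 4.2.1 (2) / Thm. 4.2.2.1 (2), `ϕ^ℤ`-form, along a certificate**: `Σ̃_{L′}` is invariant under every integer power of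
the diagonal Frobenius (E-t7's `mem_adelicAnsatz_iff_frobTuple_zpow_mem`). [claim: Joshi2024ATS3, status: disputed] -/
theorem mem_adelicAnsatz_iff_frobTuple_zpow_mem (n : ℤ) (z : D.Tuple) :
    z ∈ D.adelicAnsatz ↔ (D.frobTuple ^ n) z ∈ D.adelicAnsatz :=
  D.mem_adelicAnsatz_iff_frobTuple_zpow_mem σ.primAnsatzFrobeniusInvariant n z

/-- **[J-III] Thm. 4.2.2.1 (3) in the DIAGONAL reading along a certificate**, MODULO the one remaining input [J-2½] Thm. 4.2.3
(4) (`LStarThroughFrobenius`: `L′*` acts through powers of `ϕ_w` — not a [J-IIp] statement, so not supplied here).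
[claim: Joshi2024ATS3, status: disputed] -/
theorem ansatzLStarStableDiag (hF : D.LStarThroughFrobenius) : D.AnsatzLStarStableDiag :=
  D.ansatzLStarStableDiag_of hF σ.primAnsatzFrobeniusInvariant

/-- **[J-III] Thm. 4.2.2.1 (4) / (4.2.2.2) VALUATION SCALING along a certificate** (p.33 l.3–36: «`|−|_{K′_{w,j}} =
|−|^{j²}_{K′_{w,1}}` for `j = 1, …, ℓ*`», «fundamental consequences for global arithmetic» p.33 l.78–79): E-t7's
`valuationScaling_of` with its [J-IIp] Thm. 6.9.1 input supplied. [claim: Joshi2024ATS3, status: disputed] -/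
theorem valuationScaling : D.ValuationScaling :=
  D.valuationScaling_of σ.primAnsatzScaling

/-- Along a certificate every residue valuation of `D` — at every place `w`, through the forgetful map (4.2.1.2) and
[FF18 Prop. 2.3.20 (3)] (`forget_abs`) — is `|e(t)|_0 ^ scale`. [claim: Joshi2024ATS3, status: disputed] -/
theorem absK_eq_rpow (w : D.V) (y : D.Y w) (t : D.T (D.pOf w)) :
    D.absK w y t = (σ.proto (D.pOf w)).abs0 (σ.toE0 (D.pOf w) t) ^ (σ.proto (D.pOf w)).scale (D.forget w y) := by
  rw [D.forget_abs, σ.absK0_eq_rpow]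

/-- A residue valuation of `D` is positive at `t` as soon as `e(t) ≠ 0` in `Ē` (positive base, real exponent). [folklore] -/
theorem absK_pos {w : D.V} (y : D.Y w) {t : D.T (D.pOf w)} (ht : σ.toE0 (D.pOf w) t ≠ 0) : 0 < D.absK w y t := by
  rw [σ.absK_eq_rpow]
  exact Real.rpow_pos_of_pos ((σ.proto (D.pOf w)).abs0.pos ht) _

/-- A residue valuation of `D` at `t` differs from `1` as soon as `|e(t)|_0 ≠ 1` and `e(t) ≠ 0` (the exponent `scale` is positive).
[folklore] -/
theorem absK_ne_one {w : D.V} (y : D.Y w) {t : D.T (D.pOf w)} (ht : σ.toE0 (D.pOf w) t ≠ 0)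
    (ht1 : (σ.proto (D.pOf w)).abs0 (σ.toE0 (D.pOf w) t) ≠ 1) : D.absK w y t ≠ 1 := by
  rw [σ.absK_eq_rpow]
  intro h
  have hpos := (σ.proto (D.pOf w)).abs0.pos ht
  have hsc := (σ.proto (D.pOf w)).scale_pos (D.forget w y)
  rcases lt_or_gt_of_ne ht1 with hlt | hgt
  · exact (Real.rpow_lt_one hpos.le hlt hsc).ne h
  · exact (Real.one_lt_rpow hgt hsc).ne' h

end PrototypeSupply

end AdelicCurveDatum

/-! ## 4. Satisfiability of the certificate relative to E-t3's carrier: the «local = global» adelic datum of a prototype family -/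

/-- **A family of prototype data, one per prime** — the input of the «local = global» construction: E-t3's `PrototypeDatum`
at each `p : P` (carriers as parameters), a common `ℓ⋆ ≥ 1`, and the two binders of §1 (point-Frobenius bijective —
[J-IIp] §6.6: `ϕ` is an automorphism of `Y_{F,ℚ_p}` —, tilts perfect). HYPOTHESIS structure; nothing asserted.
[claim: Joshi2023ATS2Local, status: disputed] -/
structure PrototypeFamily (P : Type) (F B E0 Y0 : P → Type) [∀ p, Field (F p)] [∀ p, CommRing (B p)]
    [∀ p, Field (E0 p)] (K : (p : P) → Y0 p → Type) [∀ p (y : Y0 p), Field (K p y)] (G0 : P → Type) : Type where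
  /-- the prototype datum at `p` -/
  proto : (p : P) → PrototypeDatum (F p) (B p) (E0 p) (Y0 p) (K p) (G0 p)
  /-- the common `ℓ⋆` -/
  lstar : ℕ
  /-- `ℓ⋆ ≥ 1` -/
  one_le_lstar : 1 ≤ lstar
  /-- all `ℓ⋆` agree -/
  lstar_eq : ∀ p, (proto p).lstar = lstar
  /-- the point-Frobenius is a bijection -/
  frobY_bijective : ∀ p, Function.Bijective (proto p).frobY
  /-- the tilt is perfect: `p`-th roots exist -/
  perfect : ∀ (p : P) (b : F p), ∃ a : F p, a ^ (proto p).p = b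

namespace PrototypeFamily

variable {P : Type} {F B E0 Y0 : P → Type} [∀ p, Field (F p)] [∀ p, CommRing (B p)] [∀ p, Field (E0 p)]
  {K : (p : P) → Y0 p → Type} [∀ p (y : Y0 p), Field (K p y)] {G0 : P → Type}
  (Φ : PrototypeFamily P F B E0 Y0 K G0) (oddss : Set P)

/-- **The «local = global» adelic curve datum of a prototype family** (satisfiability witness for §1, NO arithmetic content):
one place per prime (`V := P`, `pOf := id`), every factor `Y w := Y0 w` with the identity as forgetful map, Galois groups and
Frobenius those of the prototype (`frob0` = the bijection `frobY`), `L′* := Unit` acting trivially, evaluation domain `T p := Ē`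
with `|z|_{K_y} := |ι_y(z)|_{K_y}`, primitive ansatz := E-t3's `primitiveAnsatz` (indices cast along `lstar_eq`); `oddss`
arbitrary. [claim: Joshi2024ATS3, status: disputed] -/
def toAdelicCurveDatum : AdelicCurveDatum where
  V := P
  oddss := oddss
  P := P
  pOf p := p
  Y := Y0
  Y0 := Y0
  forget _ y := y
  lstar := Φ.lstar
  one_le_lstar := Φ.one_le_lstar
  G := G0
  gact p g y := (Φ.proto p).galY g y
  G0 := G0
  g0act p g y := (Φ.proto p).galY g y
  res _ g := g
  forget_gal _ _ _ := rfl
  frob p := Equiv.ofBijective (Φ.proto p).frobY (Φ.frobY_bijective p)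
  frob0 p := Equiv.ofBijective (Φ.proto p).frobY (Φ.frobY_bijective p)
  forget_frob _ _ := rfl
  Lstar := Unit
  lpow _ _ := ()
  lact _ _ y := y
  lact_lpow _ n _ y := (Function.iterate_id n ▸ rfl : y = (fun y => y)^[n] y)
  T := E0
  absK p y z := (Φ.proto p).absK y ((Φ.proto p).emb y z)
  absK0 p y z := (Φ.proto p).absK y ((Φ.proto p).emb y z)
  forget_abs _ _ := rfl
  primAnsatz p := {t | (fun i : Fin (Φ.proto p).lstar => t (Fin.cast (Φ.lstar_eq p) i)) ∈ (Φ.proto p).primitiveAnsatz}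

/-- **The certificate of §1 is satisfiable relative to E-t3's carrier**: the «local = global» datum of any prototype family
carries a `PrototypeSupply` (all equations `rfl`, `toE0 := id`). [claim: Joshi2024ATS3, status: disputed] -/
def supply : (Φ.toAdelicCurveDatum oddss).PrototypeSupply F B E0 K where
  proto := Φ.proto
  lstar_eq := Φ.lstar_eq
  gal_eq _ _ _ := rfl
  frob_eq _ _ := rfl
  toE0 _ z := z
  absK0_eq _ _ _ := rfl
  primAnsatz_eq _ _ := Iff.rfl
  perfect := Φ.perfect

/-- Hence, for the «local = global» datum of any prototype family, [J-III] Thm. 4.2.2.1 (4) (valuation scaling) is a kernel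
theorem with no hypothesis beyond E-t3's signature and the two binders. [claim: Joshi2024ATS3, status: disputed] -/
theorem toAdelicCurveDatum_valuationScaling : (Φ.toAdelicCurveDatum oddss).ValuationScaling :=
  (Φ.supply oddss).valuationScaling

/-- … and so are Thm. 4.2.2.1 (1) (Galois stability) and (2) (Frobenius stability). [claim: Joshi2024ATS3, status: disputed] -/
theorem toAdelicCurveDatum_stable :
    (Φ.toAdelicCurveDatum oddss).AnsatzGaloisStable ∧ (Φ.toAdelicCurveDatum oddss).AnsatzFrobeniusStable :=
  ⟨(Φ.supply oddss).ansatzGaloisStable, (Φ.supply oddss).ansatzFrobeniusStable⟩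

end PrototypeFamily

end Summit.ABC.IUTFork.Joshi

end
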